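import Summits.ABC.ABC.Theses.IsogenyGlueCongruence
import Literature.NumberTheory.EllipticCurves.DegreeConjectureAbcMurtyProofs
import Literature.NumberTheory.EllipticCurves.PeterssonNormLowerBoundSqrtProofs
import Literature.NumberTheory.EllipticCurves.SilvermanHeightCovolumeProofs
import Literature.NumberTheory.EllipticCurves.SzpiroOfAbcProofs
import Literature.NumberTheory.EllipticCurves.DegreeConjectureAbcPrelims
import Literature.NumberTheory.DiophantineGeometry.LocalReductionProofs
import Literature.NumberTheory.DiophantineGeometry.MinimalDiscriminantNormProofs
import Literature.Barriers.ABC.SzpiroEpsilonCannotBeDroppedHolds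

set_option linter.dupNamespace false

/-!
# Disproof of `SharpDegreeOfPolyDegree` (crux R, stmt-ABC-10895) — findings

`R := SharpDegreeOfPolyDegree = (PolyDegreeBound → SemistableDegreeConjecture)`:
"polynomial modular-degree conjecture for semistable `E/ℚ` (`deg φ ≤ C N^κ`, ∃D-form)
⟹ the sharp one `X` (`∀ ε > 0, deg φ ≤ C(ε) N^{2+ε}`)".

## Verdict of this seat: NO KILL — and why it cannot be killed from inside the tree

* `not_crux_iff` : `¬ R ↔ PolyDegreeBound ∧ ¬ X`. A disproof must (a) PROVE Frey's height /
  polynomial degree conjecture for all semistable curves (open; it even needs modularity to build a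
  single `ModularParametrizationData`, which the tree only has as the named fact
  `nonempty_modularParametrizationData`) and (b) REFUTE `X`, i.e. produce a semistable family with
  `deg φ_min ≥ N^{2+δ}` — negative knowledge of summit size (`X ⟹ abc`,
  `abcLe_of_semistableDegreeBound`). Every junk scenario (empty data type for one curve, empty binder
  class) makes `R` TRUE, never false (§1).
* `not_shape_amplification` : `R` is not a consequence of the SHAPE of its two sides (real-analysis
  bookkeeping cannot lower an exponent): the abstract statement "polynomially bounded ⟹ bounded by
  `C(ε) n^{2+ε}`" is false (`d n = n⁴`). Any proof of `R` must use that `deg` is a modular degree.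

## Checked negative content (all sorry-free)

§2 EXPONENT FLOOR (tightness of the `2` in `X`, hence in `R`'s consequent):
* `not_polyDegreeBoundAt_of_lt_three_halves` — UNCONDITIONAL: no bound `deg φ ≤ C N^κ` with
  `κ < 3/2` holds over all semistable curves (Zagier's formula, proved; Iwaniec's elementary
  `(f,f) ≫ N^{1/2−δ}`, proved; Silverman's covolume inequality, proved; Masser's semistable
  Szpiro-excess curves, proved; transport to a global minimal model, proved).
* `not_polyDegreeBoundAt_of_lt_two` — modulo the route's own analytic item `PeterssonLowerBound`
  (`(f,f) ≫_ε N^{1−ε}`, Hoffstein–Lockhart): no such bound with `κ < 2`.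
* hence `not_degreeConjectureWithExponent_of_lt_*` : `X` with `2` replaced by `θ < 3/2`
  (resp. `θ < 2` mod `PeterssonLowerBound`) is FALSE, and the correspondingly strengthened crux
  `CruxWithExponent θ` is equivalent to `¬ PolyDegreeBound` (it would refute its own antecedent and
  the target): `cruxWithExponent_iff_not_polyDegreeBound_of_lt_*`.
* `target_of_polyDegreeBoundAt_le_two` + the floor: the only "free" instance of `R`
  (antecedent exponent `κ ≤ 2` ⟹ `X` by monotonicity) is `κ ∈ [3/2, 2]` unconditionally and the
  single point `κ = 2` modulo `PeterssonLowerBound`; everything else in `R` is a genuine exponent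
  drop `κ ↦ 2 + ε`, of abc strength (Murty 1999 Thm 1: on Frey curves `X ⟺ abc`, while
  `PolyDegreeBound ⟹` polynomial abc, `PolyAbcOfPolyDegree`).
* `degreeBound_two_of_const_uniform_in_eps` — an `ε`-UNIFORM constant in `X` collapses it to
  `deg ≤ C N²` (`PolyDegreeBoundAt 2`, the borderline left open by the floor).
§3 NON-VACUITY: `exists_semistable_globallyMinimal` — the binder class of `X`/`R` (semistable,
  globally minimal, elliptic, any conductor floor) is inhabited with unbounded conductor, so neither
  side is vacuous or finitely checkable.

## Load-bearing analysis
BINDER MUTATION (on paper, not Lean-checked here): the instance binder `[W.IsGloballyMinimal]` is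
load-bearing for the TARGET `X` (and for `PolyDegreeBound`), though not for `R`: for the rescaled
integral model `W_p` (`a_i ↦ p^i a_i`, `p ∤ c₀`) of a fixed curve, `Λ_{W_p} = p⁻¹ Λ_W`, the admissible
integer Manin constants are still `c₀ℤ`, and the tree's degree formula
`deg φ_D = [Λ_W : c Λ_f] · δ` (`ModularParametrizationData.modularDegree_eq_card_ker_mul_of_eichlerShimuraMap`)
gives `min_D deg = p² · min-deg(W)` at FIXED conductor; so without minimality both `X` and
`PolyDegreeBound` are junk-false and `R` junk-true. With the binder (as filed) this is moot.
`R` has one hypothesis, `PolyDegreeBound`; `R` without it is the target `X` itself (open, abc-strength;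
not refutable here). WEAKENING the hypothesis to anything provable today is impossible for the reason
in (a) above (every "∀ W ∃ D, bound" statement asserts modularity). STRENGTHENING the conclusion below
exponent `3/2` is refuted (§2). Attacks tried and why each fails to bite `R` itself: see the cdisprove
seat's NOTES (small/finite models: none — statement is `∃C`-asymptotic over an infinite class;
degenerate parameters `κ ≤ 2`: trivial slice, void below `3/2`; known counterexample families
(Masser, Bennett–Yazdani Szpiro-excess curves): excess is sub-polynomial, cannot separate `N^κ` from
`N^{2+ε}`; literature: no amplification weak-abc ⟹ strong-abc is known, none is refuted either;
`lit search` degraded this cycle (searchd rc 75), negatives index ABC = 2 unrelated items).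
-/

noncomputable section

namespace Summit.ABC.ABC.Cruxes.SharpDegreeOfPolyDegree.Disproof

open Summit.ABC.ABC.Theses.IsogenyGlueCongruence
open Literature.NumberTheory.EllipticCurves Literature.NumberTheory.EllipticCurves.ModularForms
open WeierstrassCurve CongruenceSubgroup Filter Topology

/-! ## §0 The pieces of the crux, named -/

/-- The antecedent of `R` at a FIXED exponent `κ`: every semistable elliptic curve over `ℚ` in global
minimal form admits a modular parametrisation datum at level `N_E` with `deg ≤ C · N_E^κ`.
[folklore] -/
def PolyDegreeBoundAt (κ : ℝ) : Prop :=
  ∃ C : ℝ, ∀ (W : WeierstrassCurve ℚ) [W.IsElliptic] [W.IsGloballyMinimal]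
    [NeZero (W.conductorNorm ℤ)], W.IsSemistable ℤ →
      ∃ D : ModularParametrizationData W (W.conductorNorm ℤ),
        (D.modularDegree : ℝ) ≤ C * (W.conductorNorm ℤ : ℝ) ^ κ

/-- The antecedent of `R`: the polynomial modular-degree conjecture for semistable curves
(Frey's height conjecture; Pasten–Shimura Conj. 3.2 restricted to semistable curves). [folklore] -/
def PolyDegreeBound : Prop := ∃ κ : ℝ, PolyDegreeBoundAt κ

/-- The target `X` with the exponent `2` replaced by `θ`. [folklore] -/
def DegreeConjectureWithExponent (θ : ℝ) : Prop := ∀ ε : ℝ, 0 < ε → PolyDegreeBoundAt (θ + ε)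

/-- The crux `R` with the exponent `2` of its consequent replaced by `θ`. [folklore] -/
def CruxWithExponent (θ : ℝ) : Prop := PolyDegreeBound → DegreeConjectureWithExponent θ

/-- The antecedent of `R`, verbatim, is `PolyDegreeBound`. [folklore] -/
theorem antecedent_iff :
    (∃ κ C : ℝ, ∀ (W : WeierstrassCurve ℚ) [W.IsElliptic] [W.IsGloballyMinimal]
      [NeZero (W.conductorNorm ℤ)], W.IsSemistable ℤ →
        ∃ D : ModularParametrizationData W (W.conductorNorm ℤ),
          (D.modularDegree : ℝ) ≤ C * (W.conductorNorm ℤ : ℝ) ^ κ) ↔ PolyDegreeBound :=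
  Iff.rfl

/-- The target `X` is `DegreeConjectureWithExponent 2`. [folklore] -/
theorem target_iff : SemistableDegreeConjecture ↔ DegreeConjectureWithExponent 2 := Iff.rfl

/-- The crux `R` is `PolyDegreeBound → X`. [folklore] -/
theorem crux_iff : SharpDegreeOfPolyDegree ↔ (PolyDegreeBound → SemistableDegreeConjecture) :=
  Iff.rfl

/-- The crux `R` is `CruxWithExponent 2`. [folklore] -/
theorem crux_iff' : SharpDegreeOfPolyDegree ↔ CruxWithExponent 2 := Iff.rfl

/-- Monotonicity in the exponent (`N_E ≥ 1`). [folklore] -/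
theorem PolyDegreeBoundAt.mono {κ κ' : ℝ} (h : κ ≤ κ') :
    PolyDegreeBoundAt κ → PolyDegreeBoundAt κ' := by
  rintro ⟨C, hC⟩
  refine ⟨max C 0, fun W _ _ _ hss => ?_⟩
  obtain ⟨D, hD⟩ := hC W hss
  refine ⟨D, hD.trans ?_⟩
  have hN0 : (0 : ℝ) ≤ (W.conductorNorm ℤ : ℝ) := Nat.cast_nonneg _
  have hN : (1 : ℝ) ≤ (W.conductorNorm ℤ : ℝ) := by
    exact_mod_cast NeZero.pos (W.conductorNorm ℤ)
  calc C * (W.conductorNorm ℤ : ℝ) ^ κ ≤ max C 0 * (W.conductorNorm ℤ : ℝ) ^ κ :=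
        mul_le_mul_of_nonneg_right (le_max_left _ _) (Real.rpow_nonneg hN0 _)
    _ ≤ max C 0 * (W.conductorNorm ℤ : ℝ) ^ κ' :=
        mul_le_mul_of_nonneg_left (Real.rpow_le_rpow_of_exponent_le hN h) (le_max_right _ _)

/-! ## §1 Logical position: why `R` cannot be refuted here -/

/-- `X ⟹ R` (one line): `R` carries no evidence independent of the target. [folklore] -/
theorem of_target (hX : SemistableDegreeConjecture) : SharpDegreeOfPolyDegree := fun _ => hX

/-- `X ⟹ PolyDegreeBound` (exponent `3`). [folklore] -/
theorem polyDegreeBound_of_target (hX : SemistableDegreeConjecture) : PolyDegreeBound :=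
  ⟨2 + 1, hX 1 one_pos⟩

/-- `X ⟺ PolyDegreeBound ∧ R`. [folklore] -/
theorem target_iff_polyDegreeBound_and_crux :
    SemistableDegreeConjecture ↔ PolyDegreeBound ∧ SharpDegreeOfPolyDegree :=
  ⟨fun h => ⟨polyDegreeBound_of_target h, of_target h⟩, fun h => h.2 h.1⟩

/-- **What a disproof of `R` must contain**: a PROOF of the polynomial modular-degree conjecture for
all semistable curves together with a REFUTATION of the target `X`. [folklore] -/
theorem not_crux_iff :
    ¬ SharpDegreeOfPolyDegree ↔ (PolyDegreeBound ∧ ¬ SemistableDegreeConjecture) :=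
  (not_congr crux_iff).trans Classical.not_imp

/-- The free instance of `R`: an antecedent with exponent `κ ≤ 2` already gives `X` (monotonicity).
By §2 this regime is void below `3/2` unconditionally and below `2` modulo `PeterssonLowerBound`.
[folklore] -/
theorem target_of_polyDegreeBoundAt_le_two {κ : ℝ} (hκ : κ ≤ 2) (h : PolyDegreeBoundAt κ) :
    SemistableDegreeConjecture :=
  fun ε hε => h.mono (by linarith)

/-- `R` splits off its free part: it is equivalent to its instances with exponent `κ > 2`, each of
which is a genuine exponent drop `N^κ ↦ N^{2+ε}`. [folklore] -/
theorem crux_iff_forall_gt_two :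
    SharpDegreeOfPolyDegree ↔ ∀ κ : ℝ, 2 < κ → PolyDegreeBoundAt κ → SemistableDegreeConjecture := by
  constructor
  · exact fun h κ _ hκ => h ⟨κ, hκ⟩
  · rintro h ⟨κ, hκ⟩
    rcases le_or_gt κ 2 with hle | hlt
    · exact target_of_polyDegreeBoundAt_le_two hle hκ
    · exact h κ hlt hκ

/-- **`R` is not a shape-level triviality.** The abstract amplification "any polynomially bounded
`d : ℕ → ℕ` is bounded by `C(ε) n^{2+ε}` for every `ε > 0`" is false (`d n = n⁴`, `ε = 1`): no proof
of `R` can avoid the arithmetic of modular degrees. [folklore] -/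
theorem not_shape_amplification :
    ¬ ∀ d : ℕ → ℕ, (∃ κ C : ℝ, ∀ n : ℕ, 0 < n → (d n : ℝ) ≤ C * (n : ℝ) ^ κ) →
        ∀ ε : ℝ, 0 < ε → ∃ C : ℝ, ∀ n : ℕ, 0 < n → (d n : ℝ) ≤ C * (n : ℝ) ^ (2 + ε) := by
  intro h
  have hpoly : ∃ κ C : ℝ, ∀ n : ℕ, 0 < n →
      (((fun m : ℕ => m ^ 4) n : ℕ) : ℝ) ≤ C * (n : ℝ) ^ κ := by
    refine ⟨4, 1, fun n _ => ?_⟩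
    rw [one_mul, show (4 : ℝ) = ((4 : ℕ) : ℝ) by norm_num, Real.rpow_natCast]
    push_cast
    exact le_rfl
  obtain ⟨C, hC⟩ := h (fun m => m ^ 4) hpoly 1 one_pos
  set n : ℕ := ⌈C⌉₊ + 1 with hn
  have hn0 : 0 < n := Nat.succ_pos _
  have hCn : C < n := by
    have := Nat.le_ceil C
    rw [hn]
    push_cast
    linarith
  have key := hC n hn0
  rw [show (2 : ℝ) + 1 = ((3 : ℕ) : ℝ) by norm_num, Real.rpow_natCast] at key
  push_cast at key
  have h3 : (0 : ℝ) < (n : ℝ) ^ 3 := by positivity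
  have hmul : (n : ℝ) * (n : ℝ) ^ 3 ≤ C * (n : ℝ) ^ 3 := by
    calc (n : ℝ) * (n : ℝ) ^ 3 = (n : ℝ) ^ 4 := by ring
      _ ≤ C * (n : ℝ) ^ 3 := key
  have := le_of_mul_le_mul_right hmul h3
  linarith

/-! ## §2 The exponent floor: tightness of `2` (natural strengthenings refuted) -/

/-- Lower bound for the Petersson norm of the newform of a parametrisation datum at exponent `η`:
`(f,f)_{Γ₀(N)} ≥ c · N^{1−η}`. Known unconditionally for `η > 1/2` (Iwaniec, elementary; proved in
the tree) and for every `η > 0` it is the route item `PeterssonLowerBound` (Hoffstein–Lockhart).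
[folklore] -/
def PeterssonLowerBoundAt (η : ℝ) : Prop :=
  ∃ c : ℝ, 0 < c ∧ ∀ (N : ℕ) [NeZero N] (W : WeierstrassCurve ℚ) [W.IsElliptic]
    (D : ModularParametrizationData W N),
      c * (N : ℝ) ^ (1 - η) ≤ (peterssonProduct (Gamma0 N) 2 D.f D.f).re

/-- Unconditional range `η > 1/2` (tree theorem
`HoffsteinLockhart1994_peterssonProduct_lower_bound_of_half_lt`, Iwaniec GSM 53 Thm 8.3).
[cite: Iwaniec2002, Thm. 8.3] -/
theorem peterssonLowerBoundAt_of_half_lt {η : ℝ} (hη : 1 / 2 < η) : PeterssonLowerBoundAt η :=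
  HoffsteinLockhart1994_peterssonProduct_lower_bound_of_half_lt hη

/-- Every `η > 0` from the route item `PeterssonLowerBound` (stmt-ABC-10870). [folklore] -/
theorem peterssonLowerBoundAt_of_peterssonLowerBound (hP : PeterssonLowerBound) {η : ℝ}
    (hη : 0 < η) : PeterssonLowerBoundAt η := by
  obtain ⟨c, hc, h⟩ := hP η hη
  exact ⟨c, hc, fun N _ W _ D => h N W D.f D.isNewformOf⟩

/-- **Per-curve core of the exponent floor** (all constants explicit). For a parametrisation datum
`D` of `W` (global minimal form) at level `N` with `deg ≤ C N^κ`: Zagier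
(`4π² c² (f,f) = deg · covol(Λ_W)`, proved), `c ∈ ℤ ∖ {0}` (proved), `(f,f) ≥ c₂ N^{1−η}` give
`covol(Λ_W) ≥ K N^{−e}`, `e = κ − 1 + η`; Silverman's `|Δ_W| ≤ A covol^{−(6+ε_S)}` with
`e (6 + ε_S) = 6` then gives `|Δ_W| ≤ max(A,0) K^{−(6+ε_S)} N^6`.
[cite: MurtyCongruencePrimes1999, §2] -/
theorem abs_disc_le_core {κ η e εS c₂ C C₁ K A : ℝ}
    (he : e = κ - 1 + η) (hprod : (-e) * (-(6 + εS)) = 6) (hεS : 0 < εS)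
    (hC₁ : C ≤ C₁) (hC₁0 : 0 < C₁) (hK : K = 4 * Real.pi ^ 2 * c₂ / C₁) (hK0 : 0 < K)
    (hPc : ∀ (N : ℕ) [NeZero N] (W : WeierstrassCurve ℚ) [W.IsElliptic]
      (D : ModularParametrizationData W N),
        c₂ * (N : ℝ) ^ (1 - η) ≤ (peterssonProduct (Gamma0 N) 2 D.f D.f).re)
    (hA : ∀ (W : WeierstrassCurve ℚ) [W.IsElliptic] [W.IsGloballyMinimal]
      (L : PeriodPair), IsNeronLatticeOf (W.baseChange ℂ) L →
        ((max |W.Δ| (|W.c₄| ^ 3) : ℚ) : ℝ) ≤ A * ZLattice.covolume L.lattice ^ (-(6 + εS)))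
    (W : WeierstrassCurve ℚ) [W.IsElliptic] [W.IsGloballyMinimal] {N : ℕ} [NeZero N]
    (D : ModularParametrizationData W N)
    (hD : (D.modularDegree : ℝ) ≤ C * (N : ℝ) ^ κ) :
    ((|W.Δ| : ℚ) : ℝ) ≤ max A 0 * K ^ (-(6 + εS)) * (N : ℝ) ^ (6 : ℕ) := by
  have hN0 : (0 : ℝ) < N := by exact_mod_cast Nat.pos_of_ne_zero (NeZero.ne N)
  -- Zagier's identity, real form
  have hZ := congrArg Complex.re D.zagier_degree_formula_holds
  rw [Complex.re_ofReal_mul, Complex.ofReal_re] at hZ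
  have hc0 : D.maninConstant ≠ 0 := D.maninConstant_ne_zero_holds
  have hc : (D.c : ℝ) ≠ 0 := by exact_mod_cast hc0
  have hcov : 0 < ZLattice.covolume D.L.lattice := ZLattice.covolume_pos _ _
  -- `c² ≥ 1`
  have hc2 : (1 : ℝ) ≤ (D.c : ℝ) ^ 2 := by
    have h1 : (1 : ℤ) ≤ |D.c| := Int.one_le_abs hc0
    have h2 : (1 : ℝ) ≤ |(D.c : ℝ)| := by exact_mod_cast h1
    calc (1 : ℝ) = 1 ^ 2 := by norm_num
      _ ≤ |(D.c : ℝ)| ^ 2 := pow_le_pow_left₀ zero_le_one h2 2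
      _ = (D.c : ℝ) ^ 2 := sq_abs _
  -- the degree bound in the shape of `covolume_ge_of_zagier_exp`
  have hdeg : (D.deg : ℝ) ≤ C₁ * (D.c : ℝ) ^ 2 * (N : ℝ) ^ (2 + (κ - 2)) := by
    have h2 : (2 : ℝ) + (κ - 2) = κ := by ring
    rw [h2]
    have hNκ : (0 : ℝ) ≤ (N : ℝ) ^ κ := Real.rpow_nonneg hN0.le _
    calc (D.deg : ℝ) = (D.modularDegree : ℝ) := rfl
      _ ≤ C * (N : ℝ) ^ κ := hD
      _ ≤ C₁ * (N : ℝ) ^ κ := mul_le_mul_of_nonneg_right hC₁ hNκ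
      _ = C₁ * 1 * (N : ℝ) ^ κ := by ring
      _ ≤ C₁ * (D.c : ℝ) ^ 2 * (N : ℝ) ^ κ := by gcongr
  have hPD := hPc N W D
  have hlow := covolume_ge_of_zagier_exp hN0 hC₁0 hc hcov hZ hdeg hPD
  have hexp : -(1 + (κ - 2) + η) = -e := by rw [he]; ring
  rw [hexp, ← hK] at hlow
  have hKN : 0 < K * (N : ℝ) ^ (-e) := mul_pos hK0 (Real.rpow_pos_of_pos hN0 _)
  -- Silverman on the Néron lattice of the global minimal model `W`
  have hS := hA W D.L D.isNeronLattice
  have h1 : ((|W.Δ| : ℚ) : ℝ) ≤ ((max |W.Δ| (|W.c₄| ^ 3) : ℚ) : ℝ) :=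
    Rat.cast_le.mpr (le_max_left _ _)
  have h3 : (K * (N : ℝ) ^ (-e)) ^ (-(6 + εS)) = K ^ (-(6 + εS)) * (N : ℝ) ^ (6 : ℕ) := by
    rw [Real.mul_rpow hK0.le (Real.rpow_nonneg hN0.le _), ← Real.rpow_mul hN0.le, hprod,
      show (6 : ℝ) = ((6 : ℕ) : ℝ) by norm_num, Real.rpow_natCast]
  -- generic in the covolume (a direct `calc` through `covol(Λ_W)` is too slow to elaborate)
  have h2 : ∀ x : ℝ, K * (N : ℝ) ^ (-e) ≤ x →
      A * x ^ (-(6 + εS)) ≤ max A 0 * K ^ (-(6 + εS)) * (N : ℝ) ^ (6 : ℕ) := by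
    intro x hx
    have hx0 : 0 < x := hKN.trans_le hx
    calc A * x ^ (-(6 + εS)) ≤ max A 0 * x ^ (-(6 + εS)) :=
          mul_le_mul_of_nonneg_right (le_max_left _ _) (Real.rpow_nonneg hx0.le _)
      _ ≤ max A 0 * (K * (N : ℝ) ^ (-e)) ^ (-(6 + εS)) := by
          apply mul_le_mul_of_nonneg_left _ (le_max_right _ _)
          exact Real.rpow_le_rpow_of_nonpos hKN hx (by linarith)
      _ = max A 0 * K ^ (-(6 + εS)) * (N : ℝ) ^ (6 : ℕ) := by rw [h3]; ring
  exact h1.trans (hS.trans (h2 _ hlow))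

/-- **A degree bound with exponent `κ` forces a Szpiro bound with exponent `6`, when
`0 < κ − 1 + η < 1`** and `(f,f) ≫ N^{1−η}`: for every semistable `W/ℚ` in global minimal form,
`|Δ_W| ≤ A' N_W^6` (choose `ε_S = 6(1−e)/e` in `abs_disc_le_core`).
[cite: MurtyCongruencePrimes1999, §2] -/
theorem abs_disc_le_of_polyDegreeBoundAt {κ η : ℝ} (hP : PeterssonLowerBoundAt η)
    (he0 : 0 < κ - 1 + η) (he1 : κ - 1 + η < 1) (hκ : PolyDegreeBoundAt κ) :
    ∃ A : ℝ, ∀ (W : WeierstrassCurve ℚ) [W.IsElliptic] [W.IsGloballyMinimal],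
      W.IsSemistable ℤ → ((|W.Δ| : ℚ) : ℝ) ≤ A * (W.conductorNorm ℤ : ℝ) ^ (6 : ℕ) := by
  obtain ⟨c₂, _, hPc⟩ := hP
  obtain ⟨C, hC⟩ := hκ
  obtain ⟨e, he⟩ : ∃ e : ℝ, e = κ - 1 + η := ⟨_, rfl⟩
  have he0' : 0 < e := by rw [he]; exact he0
  have he1' : e < 1 := by rw [he]; exact he1
  obtain ⟨εS, hεS⟩ : ∃ εS : ℝ, εS = 6 * (1 - e) / e := ⟨_, rfl⟩
  have hεS0 : 0 < εS := by rw [hεS]; exact div_pos (by linarith) he0'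
  have hprod : (-e) * (-(6 + εS)) = 6 := by
    rw [hεS]; field_simp; ring
  obtain ⟨A, hA⟩ := silverman1986_discriminant_c4_covolume_holds εS hεS0
  have hC₁0 : 0 < max C 1 := lt_of_lt_of_le one_pos (le_max_right _ _)
  obtain ⟨K, hK⟩ : ∃ K : ℝ, K = 4 * Real.pi ^ 2 * c₂ / max C 1 := ⟨_, rfl⟩
  have hK0 : 0 < K := by rw [hK]; positivity
  refine ⟨max A 0 * K ^ (-(6 + εS)), fun W _ _ hss => ?_⟩
  have hNpos : 0 < W.conductorNorm ℤ := conductorNorm_pos_holds W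
  haveI : NeZero (W.conductorNorm ℤ) := ⟨hNpos.ne'⟩
  obtain ⟨D, hD⟩ := hC W hss
  exact abs_disc_le_core he hprod hεS0 (le_max_left C 1) hC₁0 hK hK0 hPc hA W D hD

/-- **Transport to a global minimal model** (Silverman AEC VIII.8.3 over the PID `ℤ`; conductor,
minimal discriminant and semistability are isomorphism invariants — all tree theorems): every
elliptic `W/ℚ` has a globally minimal model `W₁` with the same conductor, `|Δ_{W₁}| = |Δ_min(W)|`,
semistable if `W` is. [cite: SilvermanAEC2009, VIII.8 Cor. 8.3] -/
theorem exists_globallyMinimal_model (W : WeierstrassCurve ℚ) [W.IsElliptic] :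
    ∃ W₁ : WeierstrassCurve ℚ, W₁.IsElliptic ∧ W₁.IsGloballyMinimal ∧
      (W.IsSemistable ℤ → W₁.IsSemistable ℤ) ∧ W₁.conductorNorm ℤ = W.conductorNorm ℤ ∧
      ((|W₁.Δ| : ℚ) : ℝ) = (W.minimalDiscriminantNorm ℤ : ℝ) := by
  obtain ⟨Cv, W₀, hCW, hmin⟩ := W.exists_baseChange_int_forall_isMinimalAt
  have hΔ0 : W₀.Δ ≠ 0 := by
    intro h0
    have h1 : (Cv • W).Δ = 0 := by
      simp [hCW, WeierstrassCurve.baseChange, WeierstrassCurve.map_Δ, h0]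
    exact (Cv • W).isUnit_Δ.ne_zero h1
  haveI hE₁ : (W₀.baseChange ℚ).IsElliptic := isElliptic_baseChange_int W₀ hΔ0
  haveI hM₁ : (W₀.baseChange ℚ).IsGloballyMinimal :=
    isGloballyMinimal_of_forall_isMinimalAt_int _ hmin
  refine ⟨W₀.baseChange ℚ, hE₁, hM₁, fun hss => ?_, ?_, ?_⟩
  · rw [← hCW]
    exact (isSemistable_smul_iff_holds ℤ W Cv).mpr hss
  · rw [← hCW, conductorNorm_smul_rat]
  · have hD₁ : W.minimalDiscriminantNorm ℤ = W₀.Δ.natAbs := by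
      rw [← minimalDiscriminantNorm_smul_rat W Cv, hCW,
        minimalDiscriminantNorm_eq_natAbs_holds W₀ hΔ0 hmin]
    have hΔ : (W₀.baseChange ℚ).Δ = (W₀.Δ : ℚ) := by
      simp [WeierstrassCurve.baseChange, WeierstrassCurve.map_Δ]
    rw [hD₁, hΔ, Nat.cast_natAbs]
    push_cast
    rfl

/-- **§3 Non-vacuity of the binder class.** Semistable elliptic curves over `ℚ` in global minimal
form exist with arbitrarily large conductor (Masser's Frey curves, transported): neither `X` nor `R`
is vacuous, and no finite computation bears on them. [cite: Masser1990, Lemma 1] -/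
theorem exists_semistable_globallyMinimal (N₀ : ℕ) :
    ∃ W : WeierstrassCurve ℚ, W.IsElliptic ∧ W.IsGloballyMinimal ∧ W.IsSemistable ℤ ∧
      N₀ < W.conductorNorm ℤ := by
  obtain ⟨W, hW, hss, hN, -⟩ :=
    Literature.Barriers.ABC.Masser.exists_semistable_curve_polylog_excess 0 0 N₀
  haveI := hW
  obtain ⟨W₁, hE₁, hM₁, hss₁, hN₁, -⟩ := exists_globallyMinimal_model W
  exact ⟨W₁, hE₁, hM₁, hss₁ hss, by rwa [hN₁]⟩

/-- **The exponent floor, master form.** If `(f,f) ≫ N^{1−η}` for newforms of elliptic curves and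
`κ + η < 2`, then `deg φ ≤ C N^κ` fails for some semistable curve in global minimal form: otherwise
`abs_disc_le_of_polyDegreeBoundAt` bounds `|Δ_min| ≤ A N^6` on ALL semistable curves (via a global
minimal model), contradicting Masser's semistable curves with `|Δ_min| > A N^6` (tree theorem
`Masser.exists_semistable_curve_polylog_excess`). [cite: Masser1990, Theorem and Lemma 1] -/
theorem not_polyDegreeBoundAt_of_peterssonLowerBoundAt {κ η : ℝ} (hP : PeterssonLowerBoundAt η)
    (hκη : κ + η < 2) : ¬ PolyDegreeBoundAt κ := by
  intro hκ
  -- move `κ` up into the window `1 − η < κ' < 2 − η`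
  set κ' : ℝ := max κ (3 / 2 - η) with hκ'
  have hκκ' : κ ≤ κ' := le_max_left _ _
  have he0 : 0 < κ' - 1 + η := by
    have := le_max_right κ (3 / 2 - η)
    linarith
  have he1 : κ' - 1 + η < 1 := by
    rcases le_total κ (3 / 2 - η) with h | h
    · rw [hκ', max_eq_right h]; linarith
    · rw [hκ', max_eq_left h]; linarith
  obtain ⟨A, hA⟩ := abs_disc_le_of_polyDegreeBoundAt hP he0 he1 (hκ.mono hκκ')
  -- Masser's semistable curve with `|Δ_min| > A N^6`
  obtain ⟨W, hW, hss, -, hlt⟩ :=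
    Literature.Barriers.ABC.Masser.exists_semistable_curve_polylog_excess 0 A 0
  haveI := hW
  rw [Real.rpow_zero, mul_one] at hlt
  obtain ⟨W₁, hE₁, hM₁, hss₁, hN₁, hΔ₁⟩ := exists_globallyMinimal_model W
  have hbound := hA W₁ (hss₁ hss)
  rw [hΔ₁, hN₁] at hbound
  exact absurd hbound (not_le.mpr hlt)

/-- **Exponent floor `3/2`, UNCONDITIONAL.** No `C, κ` with `κ < 3/2` give `deg φ ≤ C N_E^κ` for a
parametrisation of every semistable `E/ℚ` (global minimal form, level `N_E`). In particular the
antecedent of `R` can only hold with `κ ≥ 3/2`. [cite: Masser1990, Theorem] -/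
theorem not_polyDegreeBoundAt_of_lt_three_halves {κ : ℝ} (hκ : κ < 3 / 2) :
    ¬ PolyDegreeBoundAt κ :=
  not_polyDegreeBoundAt_of_peterssonLowerBoundAt
    (peterssonLowerBoundAt_of_half_lt (η := 5 / 4 - κ / 2) (by linarith)) (by linarith)

/-- **Exponent floor `2`, modulo the route item `PeterssonLowerBound`** (`(f,f) ≫_ε N^{1−ε}`,
Hoffstein–Lockhart 1994): no `C, κ` with `κ < 2` give `deg φ ≤ C N_E^κ` over all semistable `E/ℚ`.
So the exponent `2` of `X` cannot be lowered, and the free instance of `R`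
(`target_of_polyDegreeBoundAt_le_two`) is the single point `κ = 2`. [cite: HoffsteinLockhart1994, Thm. 0.1] -/
theorem not_polyDegreeBoundAt_of_lt_two (hP : PeterssonLowerBound) {κ : ℝ} (hκ : κ < 2) :
    ¬ PolyDegreeBoundAt κ :=
  not_polyDegreeBoundAt_of_peterssonLowerBoundAt
    (peterssonLowerBoundAt_of_peterssonLowerBound hP (η := (2 - κ) / 2) (by linarith)) (by linarith)

/-- Positive form of a failed degree bound: for every `C` some semistable curve in global minimal
form has ALL its parametrisation data at level `N_E` of degree `> C · N_E^κ`. [folklore] -/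
theorem exists_curve_forall_datum_gt_of_not_degreeBound {κ : ℝ}
    (h : ¬ ∃ C : ℝ, ∀ (W : WeierstrassCurve ℚ) [W.IsElliptic] [W.IsGloballyMinimal]
      [NeZero (W.conductorNorm ℤ)], W.IsSemistable ℤ →
        ∃ D : ModularParametrizationData W (W.conductorNorm ℤ),
          (D.modularDegree : ℝ) ≤ C * (W.conductorNorm ℤ : ℝ) ^ κ) (C : ℝ) :
    ∃ (W : WeierstrassCurve ℚ) (_ : W.IsElliptic) (_ : W.IsGloballyMinimal)
      (_ : NeZero (W.conductorNorm ℤ)), W.IsSemistable ℤ ∧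
        ∀ D : ModularParametrizationData W (W.conductorNorm ℤ),
          C * (W.conductorNorm ℤ : ℝ) ^ κ < (D.modularDegree : ℝ) := by
  by_contra hcon
  push Not at hcon
  exact h ⟨C, fun W hE hM hN hss => hcon W hE hM hN hss⟩

/-- **Large modular degrees, unconditionally.** For every `C` and every `κ < 3/2` there is a
semistable `E/ℚ` in global minimal form all of whose modular parametrisation data at level `N_E`
have degree `> C · N_E^κ` — the Lean form of "`deg φ_min ≥ N^{3/2−δ}` infinitely often along
Masser's family". [cite: Masser1990, Theorem] -/
theorem exists_curve_forall_datum_gt_of_lt_three_halves {κ : ℝ} (hκ : κ < 3 / 2) (C : ℝ) :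
    ∃ (W : WeierstrassCurve ℚ) (_ : W.IsElliptic) (_ : W.IsGloballyMinimal)
      (_ : NeZero (W.conductorNorm ℤ)), W.IsSemistable ℤ ∧
        ∀ D : ModularParametrizationData W (W.conductorNorm ℤ),
          C * (W.conductorNorm ℤ : ℝ) ^ κ < (D.modularDegree : ℝ) :=
  exists_curve_forall_datum_gt_of_not_degreeBound (not_polyDegreeBoundAt_of_lt_three_halves hκ) C

/-- **Large modular degrees modulo `PeterssonLowerBound`**: the same for every `κ < 2`
(`deg φ_min ≥ N^{2−δ}` infinitely often). [cite: HoffsteinLockhart1994, Thm. 0.1] -/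
theorem exists_curve_forall_datum_gt_of_lt_two (hP : PeterssonLowerBound) {κ : ℝ} (hκ : κ < 2)
    (C : ℝ) :
    ∃ (W : WeierstrassCurve ℚ) (_ : W.IsElliptic) (_ : W.IsGloballyMinimal)
      (_ : NeZero (W.conductorNorm ℤ)), W.IsSemistable ℤ ∧
        ∀ D : ModularParametrizationData W (W.conductorNorm ℤ),
          C * (W.conductorNorm ℤ : ℝ) ^ κ < (D.modularDegree : ℝ) :=
  exists_curve_forall_datum_gt_of_not_degreeBound (not_polyDegreeBoundAt_of_lt_two hP hκ) C

/-- **Natural strengthening of the target refuted (unconditional):** `X` with `2` replaced by any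
`θ < 3/2` is false. [cite: Masser1990, Theorem] -/
theorem not_degreeConjectureWithExponent_of_lt_three_halves {θ : ℝ} (hθ : θ < 3 / 2) :
    ¬ DegreeConjectureWithExponent θ := fun h =>
  not_polyDegreeBoundAt_of_lt_three_halves (κ := θ + (3 / 2 - θ) / 2) (by linarith)
    (h _ (by linarith))

/-- **Natural strengthening of the target refuted (mod `PeterssonLowerBound`):** `X` with `2`
replaced by any `θ < 2` is false — the `2` in `N^{2+ε}` is optimal. [cite: HoffsteinLockhart1994, Thm. 0.1] -/
theorem not_degreeConjectureWithExponent_of_lt_two (hP : PeterssonLowerBound) {θ : ℝ}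
    (hθ : θ < 2) : ¬ DegreeConjectureWithExponent θ := fun h =>
  not_polyDegreeBoundAt_of_lt_two hP (κ := θ + (2 - θ) / 2) (by linarith) (h _ (by linarith))

/-- **The strengthened crux is self-defeating (unconditional, `θ < 3/2`):** `CruxWithExponent θ`
holds iff its own antecedent, the polynomial modular-degree conjecture, FAILS. [folklore] -/
theorem cruxWithExponent_iff_not_polyDegreeBound_of_lt_three_halves {θ : ℝ} (hθ : θ < 3 / 2) :
    CruxWithExponent θ ↔ ¬ PolyDegreeBound :=
  ⟨fun h hp => not_degreeConjectureWithExponent_of_lt_three_halves hθ (h hp),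
    fun h hp => absurd hp h⟩

/-- **The strengthened crux is self-defeating (mod `PeterssonLowerBound`, `θ < 2`).** [folklore] -/
theorem cruxWithExponent_iff_not_polyDegreeBound_of_lt_two (hP : PeterssonLowerBound) {θ : ℝ}
    (hθ : θ < 2) : CruxWithExponent θ ↔ ¬ PolyDegreeBound :=
  ⟨fun h hp => not_degreeConjectureWithExponent_of_lt_two hP hθ (h hp), fun h hp => absurd hp h⟩

/-- … and in particular a strengthened crux with `θ < 3/2` would REFUTE the route's target `X`
(since `X ⟹ PolyDegreeBound`). [folklore] -/
theorem not_target_of_cruxWithExponent_of_lt_three_halves {θ : ℝ} (hθ : θ < 3 / 2)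
    (h : CruxWithExponent θ) : ¬ SemistableDegreeConjecture := fun hX =>
  (cruxWithExponent_iff_not_polyDegreeBound_of_lt_three_halves hθ).mp h (polyDegreeBound_of_target hX)

/-- **An `ε`-uniform constant collapses the target to exponent exactly `2`.** If ONE constant `C`
served every `ε > 0` in `X`, then (degrees being positive integers, a minimal-degree datum exists and
`C N^{2+ε} → C N²` as `ε → 0⁺`) every semistable curve would have a datum with `deg ≤ C N²`.
[folklore] -/
theorem degreeBound_two_of_const_uniform_in_eps
    (h : ∃ C : ℝ, ∀ ε : ℝ, 0 < ε → ∀ (W : WeierstrassCurve ℚ) [W.IsElliptic] [W.IsGloballyMinimal]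
      [NeZero (W.conductorNorm ℤ)], W.IsSemistable ℤ →
        ∃ D : ModularParametrizationData W (W.conductorNorm ℤ),
          (D.modularDegree : ℝ) ≤ C * (W.conductorNorm ℤ : ℝ) ^ (2 + ε)) :
    ∃ C : ℝ, ∀ (W : WeierstrassCurve ℚ) [W.IsElliptic] [W.IsGloballyMinimal]
      [NeZero (W.conductorNorm ℤ)], W.IsSemistable ℤ →
        ∃ D : ModularParametrizationData W (W.conductorNorm ℤ),
          (D.modularDegree : ℝ) ≤ C * (W.conductorNorm ℤ : ℝ) ^ (2 : ℝ) := by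
  obtain ⟨C, hC⟩ := h
  refine ⟨C, fun W _ _ _ hss => ?_⟩
  -- a datum of minimal degree
  have hne : ∃ m : ℕ, ∃ D : ModularParametrizationData W (W.conductorNorm ℤ),
      D.modularDegree = m := by
    obtain ⟨D, -⟩ := hC 1 one_pos W hss
    exact ⟨_, D, rfl⟩
  classical
  obtain ⟨D₀, hD₀⟩ := Nat.find_spec hne
  refine ⟨D₀, ?_⟩
  have hmin : ∀ D : ModularParametrizationData W (W.conductorNorm ℤ),
      D₀.modularDegree ≤ D.modularDegree := fun D => by
    rw [hD₀]
    exact Nat.find_min' hne ⟨D, rfl⟩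
  have hN0 : (0 : ℝ) < (W.conductorNorm ℤ : ℝ) := by
    exact_mod_cast NeZero.pos (W.conductorNorm ℤ)
  -- `deg D₀ ≤ C N^{2+ε}` for every `ε > 0`
  have hdeg : ∀ ε : ℝ, 0 < ε →
      (D₀.modularDegree : ℝ) ≤ C * (W.conductorNorm ℤ : ℝ) ^ (2 + ε) := by
    intro ε hε
    obtain ⟨D, hD⟩ := hC ε hε W hss
    exact le_trans (by exact_mod_cast hmin D) hD
  -- let `ε → 0⁺`
  have ht : Tendsto (fun ε : ℝ => C * (W.conductorNorm ℤ : ℝ) ^ (2 + ε)) (𝓝[>] 0)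
      (𝓝 (C * (W.conductorNorm ℤ : ℝ) ^ (2 + (0 : ℝ)))) := by
    apply Tendsto.const_mul
    have h1 : Tendsto (fun ε : ℝ => 2 + ε) (𝓝[>] (0 : ℝ)) (𝓝 (2 + 0)) :=
      ((continuous_const_add (2 : ℝ)).tendsto 0).mono_left nhdsWithin_le_nhds
    exact (Real.continuousAt_const_rpow hN0.ne').tendsto.comp h1
  rw [add_zero] at ht
  refine ge_of_tendsto ht ?_
  filter_upwards [self_mem_nhdsWithin] with ε hε
  exact hdeg ε hε

/-- In the language of this file: an `ε`-uniform constant in `X` gives `PolyDegreeBoundAt 2` — the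
borderline exponent, NOT refuted by §2 (refuting it needs `(f,f) ≫ N/(log N)^A`, i.e. no Siegel zero
for `L(s, Sym² f)` à la Goldfeld–Hoffstein–Lieman, absent from the tree; with it, Masser's polylog
excess would kill `PolyDegreeBoundAt 2` exactly as in `not_polyDegreeBoundAt_of_peterssonLowerBoundAt`).
[folklore] -/
theorem polyDegreeBoundAt_two_of_const_uniform_in_eps
    (h : ∃ C : ℝ, ∀ ε : ℝ, 0 < ε → ∀ (W : WeierstrassCurve ℚ) [W.IsElliptic] [W.IsGloballyMinimal]
      [NeZero (W.conductorNorm ℤ)], W.IsSemistable ℤ →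
        ∃ D : ModularParametrizationData W (W.conductorNorm ℤ),
          (D.modularDegree : ℝ) ≤ C * (W.conductorNorm ℤ : ℝ) ^ (2 + ε)) :
    PolyDegreeBoundAt 2 :=
  degreeBound_two_of_const_uniform_in_eps h

/-- Summary of the admissible-exponent picture modulo `PeterssonLowerBound`: the set
`{κ | PolyDegreeBoundAt κ}` is an upper set (`mono`) disjoint from `(−∞, 2)`; `X` says it contains
`(2, ∞)`; `R` says: if it is non-empty it contains `(2, ∞)`. [folklore] -/
theorem crux_iff_of_peterssonLowerBound (hP : PeterssonLowerBound) :
    SharpDegreeOfPolyDegree ↔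
      ((∃ κ : ℝ, 2 ≤ κ ∧ PolyDegreeBoundAt κ) → ∀ κ : ℝ, 2 < κ → PolyDegreeBoundAt κ) := by
  constructor
  · rintro h ⟨κ, -, hκ⟩ κ₁ hκ₁
    have hX := h ⟨κ, hκ⟩
    have := hX (κ₁ - 2) (by linarith)
    rwa [show 2 + (κ₁ - 2) = κ₁ by ring] at this
  · rintro h ⟨κ, hκ⟩ ε hε
    have h2 : 2 ≤ κ := by
      by_contra hlt
      exact not_polyDegreeBoundAt_of_lt_two hP (not_le.mp hlt) hκ
    exact h ⟨κ, h2, hκ⟩ (2 + ε) (by linarith)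

end Summit.ABC.ABC.Cruxes.SharpDegreeOfPolyDegree.Disproof
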